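import Summits.BirchSwinnertonDyer.BirchSwinnertonDyer.Theorems.AlignedTransportAtTwoMainConjectureOfRankZeroBSDAtTwoOrdinaryStandardShapeCrux
import HarnessLib

/-!
# Route `AlignedTransportAtTwo`, crux C2 `MainConjectureOfRankZeroBSDAtTwo` (stmt-BirchSwinnertonDyer-22298):
# THE CM-SEXTIC SHAPE — C2's classical input in integer-triple currency with ONE clause: «`μ₂ = 0` along the cyclotomic
# `ℤ₂`-extension of every sextic number field `ℚ(e, √−1)`, `e` a root of a shape cubic `x³ + (1+4a₂)x² + 16a₄x + 64a₆`
# (`a₄ + a₆` odd, no rational root, `Δ[1,a₂,0,a₄,a₆] ∉ ℤ²`)»; it is EQUIVALENT to g35's narrow shape input and to the curve-indexed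
# inputs, and gives C2 and the registered stub PFμ⁺ by name

HONEST FRAMING. WIDTH-5 attached prover seat `bsd-line-att-p4` g36 on line `birth` of the lead `bsd-line-att-p2` (WAKE-only); `--supports`
stmt-BirchSwinnertonDyer-22298, closes nothing; BSD is NOT proved; crux C2, its verdict «blocked-on `Rank1Residual.GreenbergMuConjectureIrreducible`»
and every registered stub (P / T / Kμ / LimDoor / MuIneqʳ / PFμ⁺ of `Lines/birth.lean` v9) untouched. THEOREMS ONLY (no `def`, no named fact, no `sorry`).
§1 and §4 are UNCONDITIONAL statements ABOUT the restatements (equivalences) — nothing is asserted about any `μ`-invariant; §2, §3 are CONDITIONAL on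
displayed named print facts (PRINT⁵ = Kato 17.4 (1)(2) at `2` `h17`, Greenberg 1999 Thm. 4.1 `hGr`, period unit `hper`, modularity `hmod`, GZK `hGZK`) and
on the registered stub MuIneqʳ VERBATIM (`hI`), exactly as every door of the lineage. Sequel of `…OrdinaryStandardShape` (ℤ-normal form),
`…OrdinaryStandardShapeExact` (exact image), `…OrdinaryStandardShapeCrux` (SHAPE ⟺ LOCAL) — att-p4 g35 — and of att-p4 g32's CM-sextic currency
`…CMSexticFieldDoor` (C2 ⟺ «`μ₂ = 0` for every abstract CM sextic `F′ ∋ e, i` over the cell's cubic `2`-torsion fields», modulo PRINT⁶ + MuIneqʳ).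
The sign split of SHAPE_CM by `sign Δ[1,a₂,0,a₄,a₆]` and the A3 witnesses are in the sequel `…OrdinaryStandardShapeCMSexticSign`.

Write, for integers `a₂ a₄ a₆` with `a₄ + a₆` odd, `g = x³ + (1+4a₂)x² + 16a₄x + 64a₆` without rational root and `Δ = Δ[1,a₂,0,a₄,a₆] ∉ ℤ²` («shape triple»):
* SHAPE_CM := «∀ shape triples, ∀ number fields `F′` of degree `6`, ∀ `e i ∈ F′` with `g(e) = 0`, `i² = −1`: `μ = 0` (growth form) for every cyclotomic
  `ℤ₂`-extension of `F′`» — ONE clause, no narrow class number, no `∃ D`;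
* LOCAL_CM := «∀ `W/ℚ` elliptic, globally minimal, good ordinary at `2`, `W(ℚ)[2] = 0`, `Δ_W ∉ ℚ²`, ∀ `F′` of degree `6` ∋ a root of `c_W` and `i`: the same»
  (= the hypothesis `hCM` of g32's `crux_of_forall_cmSextic_classicalMu` STRIPPED of the cell binders `¬CM`, `r_an = 0`, `BSD₂`);
* SHAPE := g35's narrow shape input «∀ shape triples, ∀ cubic `F ∋ e`, `g(e) = 0`: (a) `μ₂(F^cyc) = 0` ∧ (b) bounded narrow `2`-defect» and LOCAL its
  curve-indexed form (`…OrdinaryStandardShapeCrux`).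

* §1 ★★★ `shapeCM_iff_localCM` — **SHAPE_CM ⟺ LOCAL_CM**, UNCONDITIONAL (ℤ-normal form `c_W(e) = 0 ⟺ g(e − 4r) = 0`; exact image).
* §2 ★★★ `crux_of_forall_standardShape_cmSextic_classicalMu` — **SHAPE_CM + PRINT⁵ + MuIneqʳ ⟹ `MainConjectureOfRankZeroBSDAtTwo`** (ONE line through g32).
* §3 ★★ `pointFieldMuCyc_of_forall_standardShape_cmSextic_classicalMu` — the REGISTERED STUB PFμ⁺ (`PointFieldMuCycAtTwo`, body verbatim) from SHAPE_CM.
* §4 ★★★ `localCell_iff_localCM`, `narrowShape_iff_shapeCM` — **LOCAL ⟺ LOCAL_CM and SHAPE ⟺ SHAPE_CM**, UNCONDITIONAL: Kida-lite ⟸ (cell bsd-2adic w2) and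
  its converse ⟹ (att-p4 g26, Hasse norm theorem on unit signatures) on the cubic model `ℚ⟮β₀⟯ ⊆ ℚ⟮β₀⟯ ⊔ ℚ⟮i₀⟯`, transported to the abstract fields. So the
  four restatements SHAPE, SHAPE_CM, LOCAL, LOCAL_CM of C2's open classical input COINCIDE in the kernel; SHAPE_CM is the one with the simplest body.
RESTATEMENT MENU (D-0014): the planner may file `IwasawaMuTwoOfOrdinaryStandardShapeCMSextic : Prop` (= SHAPE_CM verbatim) [conjecture; OPEN IN PRINT —
Iwasawa's `μ = 0` conjecture for the non-abelian sextics `ℚ(e, √−1)`; Ferrero–Washington covers abelian fields only] — kernel-equivalent to g35's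
`NarrowMuTwoOfOrdinaryStandardShape` (§4) and to the curve-indexed inputs; by g32 §4 it differs from C2's exact classical content (mod PRINT⁶ + MuIneqʳ) only
by the cell binders `r_an = 0` / `BSD₂` / `¬CM` on the realising curves. Expected REF2 grade COROLLARY-OF-TREE. PARTITION: none; beyond-print theorem: no;
BSD is NOT proved by any of this.

References: [Greenberg2001IwasawaPastPresent] §4; [Iwasawa1973MuInvariants] Thm. 2–3, §3–§4; [Kida1982JFields] Thm. 1, Remark (ii); [Kato2004Asterisque]
Thm. 17.4; [GreenbergLNM1716] Thm. 4.1; [SilvermanAEC2009] III.§1, VIII.§8; [Washington1997] §13.3; tree: `…OrdinaryStandardShape{,Exact,Crux}` (g35),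
`…CMSexticCurrency` / `…CMSexticFieldDoor` (g32), `…PointFieldCarrierCMIff` (att-p3 g34), `NarrowDefectBoundedOfClassicalMuAdjoinI` (att-p4 g26),
`ClassicalMuVanishesAdjoinIOfNarrow` (bsd-2adic w2).
-/

-- the Theorems namespace of this sub repeats the summit name by design (D-0017 nested layout)
set_option linter.dupNamespace false
set_option autoImplicit false

noncomputable section

open scoped NumberField IntermediateField

namespace Summit.BirchSwinnertonDyer.BirchSwinnertonDyer.Theorems.AlignedTransportAtTwoOrdinaryStandardShapeCMSextic

open NumberField Polynomial WeierstrassCurve IntermediateField Field CongruenceSubgroup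
  Literature.NumberTheory.EllipticCurves Literature.NumberTheory.EllipticCurves.Greenberg1999
  Literature.NumberTheory.EllipticCurves.ModularForms Literature.NumberTheory.EllipticCurves.Rank1Residual
  Literature.NumberTheory.EllipticCurves.Module
  Literature.NumberTheory.EllipticCurves.DokchitserDokchitser2012
  Literature.NumberTheory.EllipticCurves.ZpExtension Literature.NumberTheory.GaloisRepresentations
  Literature.NumberTheory.IwasawaTheory Literature.NumberTheory.NumberFields
  Summit.BirchSwinnertonDyer.Rank1Residual Summit.BirchSwinnertonDyer.Rank1Residual.X1.MuLambda
  Summit.BirchSwinnertonDyer.Rank1Residual.X5 Summit.BirchSwinnertonDyer.Rank1Residual.F1Sign2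
  Summit.BirchSwinnertonDyer.BirchSwinnertonDyer.Theorems.Rank1ResidualX1Defs
  Summit.BirchSwinnertonDyer.BirchSwinnertonDyer.Theses.AlignedTransportAtTwo
  Summit.BirchSwinnertonDyer.BirchSwinnertonDyer.Theorems.AlignedTransportAtTwoNarrowCubicNamedInput
  Summit.BirchSwinnertonDyer.BirchSwinnertonDyer.Theorems.AlignedTransportAtTwoNarrowCubicNamedInputSignSplit
  Summit.BirchSwinnertonDyer.BirchSwinnertonDyer.Theorems.AlignedTransportAtTwoOrdinaryStandardShape
  Summit.BirchSwinnertonDyer.BirchSwinnertonDyer.Theorems.AlignedTransportAtTwoOrdinaryStandardShapeExact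
  Summit.BirchSwinnertonDyer.BirchSwinnertonDyer.Theorems.AlignedTransportAtTwoOrdinaryStandardShapeCrux
  Summit.BirchSwinnertonDyer.BirchSwinnertonDyer.Theorems.AlignedTransportAtTwoPointFieldCarrierCM
  Summit.BirchSwinnertonDyer.BirchSwinnertonDyer.Theorems.AlignedTransportAtTwoPointFieldCarrierCMIff
  Summit.BirchSwinnertonDyer.BirchSwinnertonDyer.Theorems.AlignedTransportAtTwoPointFieldCarrierGalois
  Summit.BirchSwinnertonDyer.BirchSwinnertonDyer.Theorems.AlignedTransportAtTwoSharedCubicDivisionField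
  Summit.BirchSwinnertonDyer.BirchSwinnertonDyer.Theorems.AlignedTransportAtTwoCMSexticCurrency
  Summit.BirchSwinnertonDyer.BirchSwinnertonDyer.Theorems.AlignedTransportAtTwoCMSexticFieldDoor

/-! ## §1 SHAPE_CM ⟺ LOCAL_CM (unconditional) -/

section Equivalence

/-- **SHAPE_CM ⟹ LOCAL_CM**: if for every shape triple every sextic number field containing a root of the shape cubic and a square root of `−1`
has `μ₂ = 0` along its cyclotomic `ℤ₂`-extensions, then so does every sextic number field containing a root of `c_W` and a square root of `−1` for
`W/ℚ` elliptic, globally minimal, good ordinary at `2`, `W(ℚ)[2] = 0`, `Δ_W ∉ ℚ²` (the `ℤ`-normal form: `c_W(e) = 0 ⟺ g(e − 4r) = 0`,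
`Δ[1,a₂,0,a₄,a₆] = Δ_min(W)`). UNCONDITIONAL; nothing asserted about either side. [cite: SilvermanAEC2009, III.§1 Table 3.1 and VIII.§8]
[cite: Greenberg2001IwasawaPastPresent, §4 (Iwasawa's μ = 0 conjecture)] -/
theorem localCM_of_shapeCM
    (hS : ∀ a₂ a₄ a₆ : ℤ, Odd (a₄ + a₆) →
      (∀ x : ℚ, x ^ 3 + (1 + 4 * (a₂ : ℚ)) * x ^ 2 + 16 * (a₄ : ℚ) * x + 64 * (a₆ : ℚ) ≠ 0) →
      ¬ IsSquare (⟨1, a₂, 0, a₄, a₆⟩ : WeierstrassCurve ℤ).Δ →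
      ∀ (F' : Type) [Field F'] [NumberField F'], Module.finrank ℚ F' = 6 →
      ∀ e i : F', e ^ 3 + (1 + 4 * (a₂ : F')) * e ^ 2 + 16 * (a₄ : F') * e + 64 * (a₆ : F') = 0 → i ^ 2 = -1 →
      ∀ κ : ZpExtension F' 2, κ.IsCyclotomic → ClassicalMuVanishes κ) :
    ∀ (W : WeierstrassCurve ℚ) [W.IsElliptic] [W.IsGloballyMinimal], IsOrdinaryAt W 2 →
      (∀ x : ℚ, ¬ HasRationalTwoTorsionX W x) → ¬ IsSquare W.Δ →
      ∀ (F' : Type) [Field F'] [NumberField F'], Module.finrank ℚ F' = 6 →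
      ∀ e i : F', aeval e (twoDivisionUCubic W) = 0 → i ^ 2 = -1 →
      ∀ κ : ZpExtension F' 2, κ.IsCyclotomic → ClassicalMuVanishes κ := by
  intro W _ _ hord ht hsq F' _ _ hF' e i he hi
  obtain ⟨a₂, a₄, a₆, r, hodd, hΔ, hroot⟩ := exists_standardShape_of_isOrdinaryAt W hord
  have hnsq : ¬ IsSquare (⟨1, a₂, 0, a₄, a₆⟩ : WeierstrassCurve ℤ).Δ := by
    rw [hΔ]
    rintro ⟨s, hs⟩
    exact hsq ⟨s, by rw [← cast_minimalDiscriminantInt W, hs]; push_cast; ring⟩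
  exact hS a₂ a₄ a₆ hodd (shape_ne_zero_of_forall_not_hasRationalTwoTorsionX W ht hroot) hnsq F' hF' (e - 4 * (r : F')) i
    ((hroot e).mp he) hi

/-- **LOCAL_CM ⟹ SHAPE_CM**: conversely, by THE EXACT IMAGE (`…OrdinaryStandardShapeExact`: a root of a shape cubic is, after a rational affinity, a root of
the `u`-cubic of a globally minimal good-ordinary curve with `W(ℚ)[2] = 0`, `Δ ∉ ℚ²` — in ANY field of characteristic `0`, in particular in the sextic `F′`).
UNCONDITIONAL; nothing asserted about either side. [cite: SilvermanAEC2009, VIII.§8 Cor. 8.3] [cite: Neron1964] -/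
theorem shapeCM_of_localCM
    (hL : ∀ (W : WeierstrassCurve ℚ) [W.IsElliptic] [W.IsGloballyMinimal], IsOrdinaryAt W 2 →
      (∀ x : ℚ, ¬ HasRationalTwoTorsionX W x) → ¬ IsSquare W.Δ →
      ∀ (F' : Type) [Field F'] [NumberField F'], Module.finrank ℚ F' = 6 →
      ∀ e i : F', aeval e (twoDivisionUCubic W) = 0 → i ^ 2 = -1 →
      ∀ κ : ZpExtension F' 2, κ.IsCyclotomic → ClassicalMuVanishes κ) :
    ∀ a₂ a₄ a₆ : ℤ, Odd (a₄ + a₆) →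
      (∀ x : ℚ, x ^ 3 + (1 + 4 * (a₂ : ℚ)) * x ^ 2 + 16 * (a₄ : ℚ) * x + 64 * (a₆ : ℚ) ≠ 0) →
      ¬ IsSquare (⟨1, a₂, 0, a₄, a₆⟩ : WeierstrassCurve ℤ).Δ →
      ∀ (F' : Type) [Field F'] [NumberField F'], Module.finrank ℚ F' = 6 →
      ∀ e i : F', e ^ 3 + (1 + 4 * (a₂ : F')) * e ^ 2 + 16 * (a₄ : F') * e + 64 * (a₆ : F') = 0 → i ^ 2 = -1 →
      ∀ κ : ZpExtension F' 2, κ.IsCyclotomic → ClassicalMuVanishes κ := by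
  intro a₂ a₄ a₆ hodd hirr hnsq F' _ _ hF' e i he hi
  obtain ⟨W, hE, hM, hord, ht, hsqW, e', he'⟩ := exists_cellCurve_root_of_standardShape_root hodd hirr hnsq he
  exact hL W hord ht hsqW F' hF' e' i he' hi

/-- ★★★ **SHAPE_CM ⟺ LOCAL_CM.** The CM-sextic named input of C2 in INTEGER-TRIPLE currency («`μ₂ = 0` along the cyclotomic `ℤ₂`-extension of every sextic
number field containing a root of a shape cubic `x³ + (1+4a₂)x² + 16a₄x + 64a₆` (`a₄ + a₆` odd, no rational root, `Δ[1,a₂,0,a₄,a₆] ∉ ℤ²`) and a square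
root of `−1`») is EQUIVALENT to its curve-indexed form («… containing a root of `c_W` and `√−1`, for every `W/ℚ` elliptic, globally minimal, good ordinary
at `2`, `W(ℚ)[2] = 0`, `Δ_W ∉ ℚ²»). UNCONDITIONAL; both sides are OPEN instances of Iwasawa's `μ = 0` conjecture; nothing is asserted about them.
[cite: SilvermanAEC2009, III.§1 Table 3.1 and VIII.§8 Cor. 8.3] [cite: Neron1964] [cite: Greenberg2001IwasawaPastPresent, §4 (Iwasawa's μ = 0 conjecture)] -/
theorem shapeCM_iff_localCM :
    (∀ a₂ a₄ a₆ : ℤ, Odd (a₄ + a₆) →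
      (∀ x : ℚ, x ^ 3 + (1 + 4 * (a₂ : ℚ)) * x ^ 2 + 16 * (a₄ : ℚ) * x + 64 * (a₆ : ℚ) ≠ 0) →
      ¬ IsSquare (⟨1, a₂, 0, a₄, a₆⟩ : WeierstrassCurve ℤ).Δ →
      ∀ (F' : Type) [Field F'] [NumberField F'], Module.finrank ℚ F' = 6 →
      ∀ e i : F', e ^ 3 + (1 + 4 * (a₂ : F')) * e ^ 2 + 16 * (a₄ : F') * e + 64 * (a₆ : F') = 0 → i ^ 2 = -1 →
      ∀ κ : ZpExtension F' 2, κ.IsCyclotomic → ClassicalMuVanishes κ) ↔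
    (∀ (W : WeierstrassCurve ℚ) [W.IsElliptic] [W.IsGloballyMinimal], IsOrdinaryAt W 2 →
      (∀ x : ℚ, ¬ HasRationalTwoTorsionX W x) → ¬ IsSquare W.Δ →
      ∀ (F' : Type) [Field F'] [NumberField F'], Module.finrank ℚ F' = 6 →
      ∀ e i : F', aeval e (twoDivisionUCubic W) = 0 → i ^ 2 = -1 →
      ∀ κ : ZpExtension F' 2, κ.IsCyclotomic → ClassicalMuVanishes κ) :=
  ⟨fun hS W _ _ ↦ localCM_of_shapeCM hS W, shapeCM_of_localCM⟩

end Equivalence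

/-! ## §2 C2 BY NAME from SHAPE_CM + PRINT⁵ + MuIneqʳ -/

section Cell

/-- ★★★ **SHAPE_CM + PRINT⁵ + MuIneqʳ ⟹ C2 BY NAME.** Granted PRINT {Kato 17.4 (1)(2) at `2` (every curve) `h17`, Greenberg 1999 Thm. 4.1 `hGr`, period
unit `hper`, modularity `hmod`, GZK `hGZK`} and the registered stub MuIneqʳ VERBATIM (`hI`): IF for all integers `a₂, a₄, a₆` with `a₄ + a₆` ODD,
`x³ + (1+4a₂)x² + 16a₄x + 64a₆` without rational root and `Δ[1,a₂,0,a₄,a₆]` not a square, every number field of degree `6` containing a root of it and a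
square root of `−1` has `μ = 0` (growth form) along every cyclotomic `ℤ₂`-extension, THEN `MainConjectureOfRankZeroBSDAtTwo` (§1 SHAPE_CM ⟹ LOCAL_CM, then
att-p4 g32's `crux_of_forall_cmSextic_classicalMu`, whose hypothesis asks this only on the cell). The hypothesis is OPEN IN PRINT; nothing is asserted about it.
CONDITIONAL; the item stays open; BSD is NOT proved. [cite: Greenberg2001IwasawaPastPresent, §4 (Iwasawa's μ = 0 conjecture)]
[cite: Kato2004Asterisque, Thm. 17.4 (p. 273) and §17.13 (pp. 279–280)] [cite: GreenbergLNM1716, Thm. 4.1 (p. 102) and Conj. 1.11 (p. 58)]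
[cite: Lim2017FineSelmer, §3 Thm. 3.5 and Lemma 3.2] -/
theorem crux_of_forall_standardShape_cmSextic_classicalMu
    (h17 : ∀ (V : WeierstrassCurve ℚ) [V.IsElliptic] [V.IsGloballyMinimal] [NeZero (V.conductorNorm ℤ)]
      (f : CuspForm (Gamma0 (V.conductorNorm ℤ)) 2), kato_divisibility_allPrimes V 2 (f := f))
    (hGr : Greenberg1999.thm41_charValue_rankZero_anyPrime)
    (hper : realPeriodRat_eq_unit_mul_plusPeriod_two) (hmod : nonempty_modularParametrizationData)
    (hGZK : rank_eq_analyticRank_of_analyticRank_le_one)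
    (hI : ∀ (W : WeierstrassCurve ℚ) [W.IsElliptic] [W.IsGloballyMinimal], IsOrdinaryAt W 2 →
      (∀ x : ℚ, ¬ HasRationalTwoTorsionX W x) →
      ∀ (κ : ZpExtension ℚ 2) (γ : Field.absoluteGaloisGroup ℚ), κ.IsCyclotomic →
      κ.IsTopGenerator γ → IsCyclotomicVariable 2 γ →
      ∀ ⦃N : ℕ⦄ [NeZero N] (f : CuspForm (Gamma0 N) 2), IsNewformOf W f →
      ∀ Gp : IwasawaAlgebra 2, iwasawaToPowerSeries 2 Gp = padicLFunction f (unitRoot W 2 : ℚ_[2]) →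
      ∀ (D : W.SelmerDualData κ γ) (Yr : W.FineSelmerDualDataRelaxedInf κ γ),
        lengthAt (IwasawaAlgebra 2) D.X ⟨IwasawaAlgebra.augIdealP 2, IwasawaAlgebra.isPrime_augIdealP_holds 2⟩ ≤
          lengthAt (IwasawaAlgebra 2) (IwasawaAlgebra 2 ⧸ Ideal.span {Gp})
              ⟨IwasawaAlgebra.augIdealP 2, IwasawaAlgebra.isPrime_augIdealP_holds 2⟩ +
            lengthAt (IwasawaAlgebra 2) Yr.X ⟨IwasawaAlgebra.augIdealP 2, IwasawaAlgebra.isPrime_augIdealP_holds 2⟩)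
    (hS : ∀ a₂ a₄ a₆ : ℤ, Odd (a₄ + a₆) →
      (∀ x : ℚ, x ^ 3 + (1 + 4 * (a₂ : ℚ)) * x ^ 2 + 16 * (a₄ : ℚ) * x + 64 * (a₆ : ℚ) ≠ 0) →
      ¬ IsSquare (⟨1, a₂, 0, a₄, a₆⟩ : WeierstrassCurve ℤ).Δ →
      ∀ (F' : Type) [Field F'] [NumberField F'], Module.finrank ℚ F' = 6 →
      ∀ e i : F', e ^ 3 + (1 + 4 * (a₂ : F')) * e ^ 2 + 16 * (a₄ : F') * e + 64 * (a₆ : F') = 0 → i ^ 2 = -1 →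
      ∀ κ : ZpExtension F' 2, κ.IsCyclotomic → ClassicalMuVanishes κ) :
    MainConjectureOfRankZeroBSDAtTwo :=
  crux_of_forall_cmSextic_classicalMu h17 hGr hper hmod hGZK hI
    (fun W _ _ _ hord ht hsq _ _ F' _ _ hF' e i he hi ↦ localCM_of_shapeCM hS W hord ht hsq F' hF' e i he hi)

end Cell

/-! ## §3 The registered stub PFμ⁺ from SHAPE_CM -/

section Stub

/-- ★★ **THE REGISTERED STUB PFμ⁺ (`PointFieldMuCycAtTwo`, body verbatim) FROM SHAPE_CM.** «`μ₂ = 0` along the cyclotomic `ℤ₂`-extension of every sextic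
number field containing a root of a shape cubic and `√−1`» ⟹ for every seed-cell `W` (binders of the stub verbatim) and every `i² = −1`: `μ₂ = 0` for
every cyclotomic `ℤ₂`-extension of `ℚ(W[2]) ⊔ ℚ⟮i⟯`. (§1 on the model `ℚ⟮β₀⟯ ⊔ ℚ⟮i⟯` — a sextic containing `4β₀` and `i` —, then att-p3 g34's ascent
`classicalMuVanishes_sup_adjoin_I_iff_pointFieldCM_of_isOrdinaryAt`.) With this the skeleton road (b″) {P, LimDoor, MuIneqʳ, PFμ⁺ ⟹ T ⟹ C2} is
sorry-free MODULO {PRINT⁵, LimDoor, MuIneqʳ} and ONE one-clause conjecture on integer triples. CONDITIONAL; nothing closed; BSD is NOT proved.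
[cite: Iwasawa1973MuInvariants, Thm. 2 and Thm. 3, §3] [cite: Greenberg2001IwasawaPastPresent, §4] -/
theorem pointFieldMuCyc_of_forall_standardShape_cmSextic_classicalMu
    (hS : ∀ a₂ a₄ a₆ : ℤ, Odd (a₄ + a₆) →
      (∀ x : ℚ, x ^ 3 + (1 + 4 * (a₂ : ℚ)) * x ^ 2 + 16 * (a₄ : ℚ) * x + 64 * (a₆ : ℚ) ≠ 0) →
      ¬ IsSquare (⟨1, a₂, 0, a₄, a₆⟩ : WeierstrassCurve ℤ).Δ →
      ∀ (F' : Type) [Field F'] [NumberField F'], Module.finrank ℚ F' = 6 →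
      ∀ e i : F', e ^ 3 + (1 + 4 * (a₂ : F')) * e ^ 2 + 16 * (a₄ : F') * e + 64 * (a₆ : F') = 0 → i ^ 2 = -1 →
      ∀ κ : ZpExtension F' 2, κ.IsCyclotomic → ClassicalMuVanishes κ) :
    ∀ (W : WeierstrassCurve ℚ) [W.IsElliptic] [W.IsGloballyMinimal], ¬ W.HasCM →
      IsOrdinaryAt W 2 → (∀ x : ℚ, ¬ HasRationalTwoTorsionX W x) → ¬ IsSquare W.Δ →
      W.analyticRank = 0 → BSDp W 2 →
      ∀ i : AlgebraicClosure ℚ, i ^ 2 = -1 →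
      ∀ κL : ZpExtension ↥(W.divisionField 2 ⊔ IntermediateField.adjoin ℚ {i}) 2,
        κL.IsCyclotomic → ClassicalMuVanishes κL := by
  intro W _ _ _ hord ht hsq _ _ i hi κL hκL
  have hP := forall_classicalMuVanishes_model_of_forall_cmSextic W ht 0 hi (localCM_of_shapeCM hS W hord ht hsq)
  exact (classicalMuVanishes_sup_adjoin_I_iff_pointFieldCM_of_isOrdinaryAt W hord ht hsq hi 0).mpr hP κL hκL

end Stub

/-! ## §4 LOCAL ⟺ LOCAL_CM and SHAPE ⟺ SHAPE_CM: the narrow (Kida) clauses and the CM clause carry the same statement -/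

section Narrow

/-- **LOCAL (narrow, g35) ⟹ LOCAL_CM.** For `W` elliptic, globally minimal, good ordinary at `2`, `W(ℚ)[2] = 0`, `Δ_W ∉ ℚ²`: IF every cubic number field
containing a root of `c_W` has (a) `μ₂ = 0` along every cyclotomic `ℤ₂`-extension and (b) bounded narrow `2`-defect along them, THEN every sextic number
field containing a root of `c_W` and `√−1` has `μ₂ = 0` along every cyclotomic `ℤ₂`-extension: (a) ∧ (b) on the cubic model `ℚ⟮β₀⟯ ∋ 4β₀`, Kida-lite
(cell bsd-2adic w2, via att-p3 g34's `…_iff_classicalMu_and_narrowDefect_le_cubic_of_isOrdinaryAt`) to `ℚ(W[2]) ⊔ ℚ⟮i₀⟯`, then g32's transport to the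
abstract `F′`. UNCONDITIONAL; nothing asserted about either side. [cite: Kida1982JFields, Thm. 1 (p. 340)] [cite: Iwasawa1973MuInvariants, Thm. 2 and Thm. 3, §3–§4] -/
theorem localCM_of_localCell
    (hL : ∀ (W : WeierstrassCurve ℚ) [W.IsElliptic] [W.IsGloballyMinimal], IsOrdinaryAt W 2 →
      (∀ x : ℚ, ¬ HasRationalTwoTorsionX W x) → ¬ IsSquare W.Δ →
      ∀ (F : Type) [Field F] [NumberField F], Module.finrank ℚ F = 3 → ∀ e : F, aeval e (twoDivisionUCubic W) = 0 →
      (∀ κ : ZpExtension F 2, κ.IsCyclotomic → ClassicalMuVanishes κ) ∧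
        ∃ D : ℕ, ∀ κ : ZpExtension F 2, κ.IsCyclotomic → ∀ n : ℕ, ∀ [NumberField ↥(κ.layer n)],
          padicValNat 2 (narrowClassNumber ↥(κ.layer n)) ≤ padicValNat 2 (classNumber ↥(κ.layer n)) + D) :
    ∀ (W : WeierstrassCurve ℚ) [W.IsElliptic] [W.IsGloballyMinimal], IsOrdinaryAt W 2 →
      (∀ x : ℚ, ¬ HasRationalTwoTorsionX W x) → ¬ IsSquare W.Δ →
      ∀ (F' : Type) [Field F'] [NumberField F'], Module.finrank ℚ F' = 6 →
      ∀ e i : F', aeval e (twoDivisionUCubic W) = 0 → i ^ 2 = -1 →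
      ∀ κ : ZpExtension F' 2, κ.IsCyclotomic → ClassicalMuVanishes κ := by
  intro W _ _ hord ht hsq F' _ _ hF' e i he hi
  obtain ⟨i₀, hi₀⟩ : ∃ i₀ : AlgebraicClosure ℚ, i₀ ^ 2 = -1 := IsAlgClosed.exists_pow_nat_eq (-1) two_pos
  set B : IntermediateField ℚ (AlgebraicClosure ℚ) := ℚ⟮xT W two_ne_zero 0⟯ with hB
  haveI : FiniteDimensional ℚ ↥B := adjoin.finiteDimensional ((AlgebraicClosure.isAlgebraic ℚ).isAlgebraic _).isIntegral
  haveI : NumberField ↥B := NumberField.mk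
  have h3 : Module.finrank ℚ ↥B = 3 := finrank_adjoin_xT_model W ht 0
  have h4mem : (4 : AlgebraicClosure ℚ) * xT W two_ne_zero 0 ∈ B := mul_mem (ofNat_mem B 4) (mem_adjoin_simple_self ℚ _)
  have heB : aeval (⟨4 * xT W two_ne_zero 0, h4mem⟩ : ↥B) (twoDivisionUCubic W) = 0 :=
    aeval_mk_eq_zero_of_aeval_eq_zero W B (aeval_four_mul_xT_twoDivisionUCubic W 0) h4mem
  obtain ⟨hμ, D, hδ⟩ := hL W hord ht hsq ↥B h3 _ heB
  have hL' := (classicalMuVanishes_sup_adjoin_I_iff_classicalMu_and_narrowDefect_le_cubic_of_isOrdinaryAt W hord ht hsq hi₀ 0).mpr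
    ⟨hμ, D, fun κP hκP n inst ↦ @hδ κP hκP n inst⟩
  exact (forall_classicalMuVanishes_sup_adjoin_I_iff_cmSextic_of_isOrdinaryAt W ht hF' he hi hord hsq hi₀).mp hL'

/-- **LOCAL_CM ⟹ LOCAL (narrow, g35)** — the CONVERSE: `μ₂ = 0` for the sextics `F′ ∋ e, i` over `W` forces (a) ∧ (b) on every cubic `F ∋` root of `c_W`:
LOCAL_CM on the model `ℚ⟮β₀⟯ ⊔ ℚ⟮i₀⟯` (g32's `forall_classicalMuVanishes_model_of_forall_cmSextic`), att-p4 g26's converse of Kida-lite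
`classicalMu_sup_adjoin_iff_classicalMu_and_narrowDefect_le` (genus theory with signatures + Hasse's norm theorem) down to `ℚ⟮β₀⟯`, and transport of
(a) ∧ (b) along `ℚ⟮β₀⟯ ≃ₐ[ℚ] F` (`√2 ∉` a cubic field). UNCONDITIONAL; nothing asserted about either side. [cite: Iwasawa1973MuInvariants, Thm. 2 and Thm. 3, §3–§4]
[cite: Washington1997, §13.3 Prop. 13.22–13.23] [cite: Gras2003, IV.4 (genus theory with signatures)] -/
theorem localCell_of_localCM
    (hL : ∀ (W : WeierstrassCurve ℚ) [W.IsElliptic] [W.IsGloballyMinimal], IsOrdinaryAt W 2 →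
      (∀ x : ℚ, ¬ HasRationalTwoTorsionX W x) → ¬ IsSquare W.Δ →
      ∀ (F' : Type) [Field F'] [NumberField F'], Module.finrank ℚ F' = 6 →
      ∀ e i : F', aeval e (twoDivisionUCubic W) = 0 → i ^ 2 = -1 →
      ∀ κ : ZpExtension F' 2, κ.IsCyclotomic → ClassicalMuVanishes κ) :
    ∀ (W : WeierstrassCurve ℚ) [W.IsElliptic] [W.IsGloballyMinimal], IsOrdinaryAt W 2 →
      (∀ x : ℚ, ¬ HasRationalTwoTorsionX W x) → ¬ IsSquare W.Δ →
      ∀ (F : Type) [Field F] [NumberField F], Module.finrank ℚ F = 3 → ∀ e : F, aeval e (twoDivisionUCubic W) = 0 →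
      (∀ κ : ZpExtension F 2, κ.IsCyclotomic → ClassicalMuVanishes κ) ∧
        ∃ D : ℕ, ∀ κ : ZpExtension F 2, κ.IsCyclotomic → ∀ n : ℕ, ∀ [NumberField ↥(κ.layer n)],
          padicValNat 2 (narrowClassNumber ↥(κ.layer n)) ≤ padicValNat 2 (classNumber ↥(κ.layer n)) + D := by
  intro W _ _ hord ht hsq F _ _ hF e he
  obtain ⟨i₀, hi₀⟩ : ∃ i₀ : AlgebraicClosure ℚ, i₀ ^ 2 = -1 := IsAlgClosed.exists_pow_nat_eq (-1) two_pos
  set B : IntermediateField ℚ (AlgebraicClosure ℚ) := ℚ⟮xT W two_ne_zero 0⟯ with hB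
  haveI : FiniteDimensional ℚ ↥B := adjoin.finiteDimensional ((AlgebraicClosure.isAlgebraic ℚ).isAlgebraic _).isIntegral
  haveI : NumberField ↥B := NumberField.mk
  have hodd : Odd (Module.finrank ℚ ↥B) := by rw [finrank_adjoin_xT_model W ht 0]; decide
  -- `μ₂ = 0` on the CM model `ℚ⟮β₀⟯ ⊔ ℚ⟮i₀⟯` from LOCAL_CM, then the converse of Kida-lite down to `ℚ⟮β₀⟯`
  have hP : ∀ κP : ZpExtension ↥(B ⊔ IntermediateField.adjoin ℚ ({i₀} : Set (AlgebraicClosure ℚ))) 2,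
      κP.IsCyclotomic → ClassicalMuVanishes κP :=
    forall_classicalMuVanishes_model_of_forall_cmSextic W ht 0 hi₀ (hL W hord ht hsq)
  obtain ⟨hμ, hb⟩ := (classicalMu_sup_adjoin_iff_classicalMu_and_narrowDefect_le B hodd hi₀).mp hP
  -- transport along `ℚ⟮β₀⟯ ≃ₐ[ℚ] F`
  obtain ⟨φ⟩ := nonempty_algEquiv_adjoin_xT W ht hF he 0
  have h2 : ∀ x : ↥B, x ^ 2 ≠ 2 := sq_ne_two_of_odd_finrank hodd
  exact ⟨(forall_classicalMuVanishes_iff_adjoin_xT_of_root W ht hF he 0).mpr hμ,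
    (exists_narrowDefect_le_iff_of_algEquiv_of_forall_sq_ne_two φ h2).mp hb⟩

/-- ★★★ **LOCAL ⟺ LOCAL_CM** (UNCONDITIONAL): on C2's local binders (`W` elliptic, globally minimal, good ordinary at `2`, `W(ℚ)[2] = 0`, `Δ_W ∉ ℚ²`) the
curve-indexed Kida-lite input «(a) `μ₂(F^cyc) = 0` ∧ (b) bounded narrow `2`-defect for every cubic `F ∋` root of `c_W`» and the curve-indexed CM input
«`μ₂(F′^cyc) = 0` for every sextic `F′ ∋` root of `c_W`, `√−1`» COINCIDE. [cite: Kida1982JFields, Thm. 1 (p. 340)] [cite: Iwasawa1973MuInvariants, Thm. 2 and Thm. 3, §3–§4]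
[cite: Washington1997, §13.3 Prop. 13.22–13.23] -/
theorem localCell_iff_localCM :
    (∀ (W : WeierstrassCurve ℚ) [W.IsElliptic] [W.IsGloballyMinimal], IsOrdinaryAt W 2 →
      (∀ x : ℚ, ¬ HasRationalTwoTorsionX W x) → ¬ IsSquare W.Δ →
      ∀ (F : Type) [Field F] [NumberField F], Module.finrank ℚ F = 3 → ∀ e : F, aeval e (twoDivisionUCubic W) = 0 →
      (∀ κ : ZpExtension F 2, κ.IsCyclotomic → ClassicalMuVanishes κ) ∧
        ∃ D : ℕ, ∀ κ : ZpExtension F 2, κ.IsCyclotomic → ∀ n : ℕ, ∀ [NumberField ↥(κ.layer n)],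
          padicValNat 2 (narrowClassNumber ↥(κ.layer n)) ≤ padicValNat 2 (classNumber ↥(κ.layer n)) + D) ↔
    (∀ (W : WeierstrassCurve ℚ) [W.IsElliptic] [W.IsGloballyMinimal], IsOrdinaryAt W 2 →
      (∀ x : ℚ, ¬ HasRationalTwoTorsionX W x) → ¬ IsSquare W.Δ →
      ∀ (F' : Type) [Field F'] [NumberField F'], Module.finrank ℚ F' = 6 →
      ∀ e i : F', aeval e (twoDivisionUCubic W) = 0 → i ^ 2 = -1 →
      ∀ κ : ZpExtension F' 2, κ.IsCyclotomic → ClassicalMuVanishes κ) :=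
  ⟨fun h W _ _ ↦ localCM_of_localCell h W, fun h W _ _ ↦ localCell_of_localCM h W⟩

/-- ★★★ **SHAPE ⟺ SHAPE_CM (both W-free, integer-triple currency).** g35's narrow shape input «for every shape triple and every cubic number field `F ∋ e`
with `g(e) = 0`: (a) `μ₂ = 0` along every cyclotomic `ℤ₂`-extension of `F` ∧ (b) `∃ D`, `ord₂ h⁺(F_n) ≤ ord₂ h(F_n) + D` along them» is EQUIVALENT to the
one-clause CM input «for every shape triple and every sextic number field `F′ ∋ e, i` with `g(e) = 0`, `i² = −1`: `μ₂ = 0` along every cyclotomic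
`ℤ₂`-extension of `F′`» — through the curve-indexed forms: SHAPE ⟺ LOCAL (g35) ⟺ LOCAL_CM ⟺ SHAPE_CM (§1). UNCONDITIONAL; both are OPEN conjectures
(Iwasawa `μ = 0` for the sextics `ℚ(e, √−1)`; Iwasawa / Greenberg–Kida in narrow form for the cubics `ℚ(e)`); nothing is asserted about them.
[cite: Kida1982JFields, Thm. 1 (p. 340) and Remark (ii) (p. 341)] [cite: Iwasawa1973MuInvariants, Thm. 2 and Thm. 3, §3–§4]
[cite: Washington1997, §13.3 Prop. 13.22–13.23] [cite: Greenberg2001IwasawaPastPresent, §4 (Iwasawa's μ = 0 conjecture)] -/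
theorem narrowShape_iff_shapeCM :
    (∀ a₂ a₄ a₆ : ℤ, Odd (a₄ + a₆) →
      (∀ x : ℚ, x ^ 3 + (1 + 4 * (a₂ : ℚ)) * x ^ 2 + 16 * (a₄ : ℚ) * x + 64 * (a₆ : ℚ) ≠ 0) →
      ¬ IsSquare (⟨1, a₂, 0, a₄, a₆⟩ : WeierstrassCurve ℤ).Δ →
      ∀ (F : Type) [Field F] [NumberField F], Module.finrank ℚ F = 3 →
      ∀ e : F, e ^ 3 + (1 + 4 * (a₂ : F)) * e ^ 2 + 16 * (a₄ : F) * e + 64 * (a₆ : F) = 0 →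
      (∀ κ : ZpExtension F 2, κ.IsCyclotomic → ClassicalMuVanishes κ) ∧
        ∃ D : ℕ, ∀ κ : ZpExtension F 2, κ.IsCyclotomic → ∀ n : ℕ, ∀ [NumberField ↥(κ.layer n)],
          padicValNat 2 (narrowClassNumber ↥(κ.layer n)) ≤ padicValNat 2 (classNumber ↥(κ.layer n)) + D) ↔
    (∀ a₂ a₄ a₆ : ℤ, Odd (a₄ + a₆) →
      (∀ x : ℚ, x ^ 3 + (1 + 4 * (a₂ : ℚ)) * x ^ 2 + 16 * (a₄ : ℚ) * x + 64 * (a₆ : ℚ) ≠ 0) →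
      ¬ IsSquare (⟨1, a₂, 0, a₄, a₆⟩ : WeierstrassCurve ℤ).Δ →
      ∀ (F' : Type) [Field F'] [NumberField F'], Module.finrank ℚ F' = 6 →
      ∀ e i : F', e ^ 3 + (1 + 4 * (a₂ : F')) * e ^ 2 + 16 * (a₄ : F') * e + 64 * (a₆ : F') = 0 → i ^ 2 = -1 →
      ∀ κ : ZpExtension F' 2, κ.IsCyclotomic → ClassicalMuVanishes κ) :=
  narrowMu_standardShape_iff_localCell.trans (localCell_iff_localCM.trans shapeCM_iff_localCM.symm)

end Narrow

end Summit.BirchSwinnertonDyer.BirchSwinnertonDyer.Theorems.AlignedTransportAtTwoOrdinaryStandardShapeCMSextic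

end
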